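import Mathlib
import HarnessLib
import Literature.MathematicalPhysics.StatisticalMechanics.TorusFRDStepKernelMultipliers
import Literature.MathematicalPhysics.StatisticalMechanics.StepOperatorAGamma
import Literature.MathematicalPhysics.StatisticalMechanics.StepOperatorABKM
import Literature.MathematicalPhysics.StatisticalMechanics.FluctuationOfHamiltonian

/-!
# Lipschitz dependence of the shift `γ_q = gradCov 𝒞_{1+q,k+1}` of the step `A_k^{(q)}` on the tuning
# parameter ([ABKM19] Ch. 12, hypothesis `ha` of Lemma 12.6; Theorem 6.1 (iv) with `ℓ = 1`)

The linear step `A_k^{(q)} = stepOpAEquiv γ(𝒞^{(q)}_{k+1})` of [ABKM19] Theorem 6.8 depends on `q`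
only through the second differences `γ_p(𝒞^{(q)}_{k+1}) = −∇²𝒞^{(q)}_{k+1}` of the step kernel at the
origin.  Clause (iv) of the finite-range decomposition (`GradientFRD.TorusFRD`, Buchholz 2018 Thm 2.4)
bounds the derivative of every real-space difference `s ↦ ∇^α𝒞_{A+sB,k}(x)` in a unit symmetric
direction by `C_{α,1} L^{−(k−1)(d−2+|α|)}`; integrating along the segment `1 + tB`, `t ∈ [0,T]` (which
stays elliptic for `T ≤ ½`, `TorusFRDStepKernelMultipliers.isElliptic_one_add_smul`):

* `abs_iterDiff_segment_sub_le` — the mean-value step for one difference `∇^θ` at one point, for a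
  kernel family `A ↦ 𝒦_A` differentiable along the segment with `|∂_s ∇^θ𝒦_{A_t+sB}(x)|_{s=0}| ≤ D`:
  `|∇^θ𝒦_{A₀+TB}(x) − ∇^θ𝒦_{A₀}(x)| ≤ D · T`;
* **`abs_gradCov_sub_le_of_torusFRD`** — for the torus package (clause (iv) for every elliptic `A`),
  `B` unit symmetric, `0 ≤ T ≤ ½`, `1 ≤ k ≤ N+1`, `n ≥ 2`:
  `L^{(k−1)d} · |γ_p(𝒞_{1+TB,k}) − γ_p(𝒞_{1,k})| ≤ secondDiffConst (C_{·,1}) · T` for every quadratic index `p`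
  — the kernel half of hypothesis `ha` (`‖(A^h_k)⁻¹ − (A^{h'}_k)⁻¹‖ ≤ a₀‖h − h'‖`) of
  `RGFlow.exists_isTunedQ_initial_eq`.

Everything is proved; no named fact.  Not here: the operator half (`stepOpAEquiv` is affine in `γ`).

## References
* S. Adams, S. Buchholz, R. Kotecký, S. Müller, arXiv:1910.13564, Theorem 6.1 (iv), Lemma 10.5,
  Ch. 12 (12.50)–(12.56) [AdamsBuchholzKoteckyMuller2019].
* S. Buchholz, J. Funct. Anal. 275 (2018), Thm 2.4 [Buchholz2016].
-/

noncomputable section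

namespace Literature.MathematicalPhysics.StatisticalMechanics.GradientRG

open Real Set Finset
open Literature.MathematicalPhysics.StatisticalMechanics.GradientFRD
  (IsElliptic IsUnitSymm iterDiff isElliptic_one)

variable {d M : ℕ} [NeZero M]

/-- **Mean-value step for one difference along a segment**: if for every `t ∈ [0,T]` all real-space
values `s ↦ 𝒦_{A₀+tB+sB}(y)` are differentiable at `0` and
`|d/ds ∇^θ𝒦_{A₀+tB+sB}(x)|_{s=0}| ≤ D`, then `|∇^θ𝒦_{A₀+TB}(x) − ∇^θ𝒦_{A₀}(x)| ≤ D · T`.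
[cite: AdamsBuchholzKoteckyMuller2019, Theorem 6.1 (iv)] -/
theorem abs_iterDiff_segment_sub_le {𝒦 : Matrix (Fin d) (Fin d) ℝ → (Fin d → ZMod M) → ℝ}
    {A₀ B : Matrix (Fin d) (Fin d) ℝ} {T D : ℝ} (hT : 0 ≤ T) (θ : Fin d → ℕ) (x : Fin d → ZMod M)
    (hdiff : ∀ t ∈ Icc 0 T, ∀ y, DifferentiableAt ℝ (fun s : ℝ => 𝒦 (A₀ + t • B + s • B) y) 0)
    (hbound : ∀ t ∈ Icc 0 T,
      |iteratedDeriv 1 (fun s : ℝ => iterDiff θ (𝒦 (A₀ + t • B + s • B)) x) 0| ≤ D) :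
    |iterDiff θ (𝒦 (A₀ + T • B)) x - iterDiff θ (𝒦 A₀) x| ≤ D * T := by
  -- the curve of kernels and the linear functional `∇^θ(·)(x)`
  set Φ := iterDiffLM (M := M) θ x with hΦ
  set f : ℝ → ℝ := fun u => iterDiff θ (𝒦 (A₀ + u • B)) x with hf
  -- differentiability of `u ↦ 𝒦 (A₀ + u • B)` (all coordinates) at every `u ∈ [0,T]`, by reparametrisation
  have hcurve : ∀ u ∈ Icc 0 T, HasDerivAt f
      (deriv (fun s : ℝ => iterDiff θ (𝒦 (A₀ + u • B + s • B)) x) 0) u := by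
    intro u hu
    set G : ℝ → ((Fin d → ZMod M) → ℝ) := fun s => 𝒦 (A₀ + u • B + s • B) with hG
    have hGd : DifferentiableAt ℝ G 0 := differentiableAt_pi.2 fun y => hdiff u hu y
    -- `s ↦ ∇^θ G(s)(x) = Φ (G s)` is differentiable at `0`
    set g : ℝ → ℝ := fun s => iterDiff θ (𝒦 (A₀ + u • B + s • B)) x with hg
    have hgΦ : g = fun s => Φ.toContinuousLinearMap (G s) := by
      funext s; simp [hg, hΦ, hG, iterDiffLM]
    have hgd : DifferentiableAt ℝ g 0 := by
      rw [hgΦ]; exact (Φ.toContinuousLinearMap.differentiableAt).comp 0 hGd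
    have hg0 : HasDerivAt g (deriv g 0) 0 := hgd.hasDerivAt
    -- reparametrise `u' ↦ g (u' − u)`
    set sh : ℝ → ℝ := fun u' => u' - u with hsh
    have hsub : HasDerivAt sh 1 u := (hasDerivAt_id u).sub_const u
    have hsh0 : sh u = 0 := sub_self u
    have hg0' : HasDerivAt g (deriv g 0) (sh u) := by rw [hsh0]; exact hg0
    have hcomp : HasDerivAt (g ∘ sh) (deriv g 0 * 1) u := hg0'.comp u hsub
    have hfun : (g ∘ sh) = f := by
      funext u'
      simp only [Function.comp_apply, hg, hf, hsh]
      congr 2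
      rw [add_assoc, ← add_smul, add_sub_cancel]
    rw [hfun, mul_one] at hcomp
    exact hcomp
  -- mean value inequality on `[0, T]`
  have hderivW : ∀ u ∈ Icc 0 T, HasDerivWithinAt f
      (deriv (fun s : ℝ => iterDiff θ (𝒦 (A₀ + u • B + s • B)) x) 0) (Icc 0 T) u :=
    fun u hu => (hcurve u hu).hasDerivWithinAt
  have hboundW : ∀ u ∈ Ico 0 T, ‖deriv (fun s : ℝ => iterDiff θ (𝒦 (A₀ + u • B + s • B)) x) 0‖ ≤ D := by
    intro u hu
    have h := hbound u (Ico_subset_Icc_self hu)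
    rw [iteratedDeriv_one] at h
    rw [Real.norm_eq_abs]; exact h
  have hmv := norm_image_sub_le_of_norm_deriv_le_segment' hderivW hboundW T (right_mem_Icc.2 hT)
  rw [sub_zero, Real.norm_eq_abs] at hmv
  have h0 : f 0 = iterDiff θ (𝒦 A₀) x := by simp [hf]
  have h1 : f T = iterDiff θ (𝒦 (A₀ + T • B)) x := rfl
  rw [h0, h1] at hmv
  exact hmv

/-- **Lipschitz dependence of `γ_p(𝒞_{1+q,k})` on `q` from the torus decomposition** (clause (iv) of
`TorusFRD d` for every `A ∈ 𝓛(½,2)`, `ℓ = 1`, `|α| = 2`): for `B` unit symmetric, `0 ≤ T ≤ ½`,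
`1 ≤ k ≤ N + 1`, `n ≥ 2`, and every quadratic index `p`,
`L^{(k−1)d} · |γ_p(𝒞_{1+TB,k}) − γ_p(𝒞_{1,k})| ≤ secondDiffConst (α ↦ C_{α,1}) · T`.
[cite: AdamsBuchholzKoteckyMuller2019, Theorem 6.1 (iv)] -/
theorem abs_gradCov_sub_le_of_torusFRD
    {𝒞 : Matrix (Fin d) (Fin d) ℝ → ℕ → (Fin d → ZMod M) → ℝ} {Cα : (Fin d → ℕ) → ℕ → ℝ} {L N n : ℕ}
    (hiv : ∀ A : Matrix (Fin d) (Fin d) ℝ, IsElliptic (1 / 2 : ℝ) 2 A →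
      ∀ k, 1 ≤ k → k ≤ N + 1 → ∀ B : Matrix (Fin d) (Fin d) ℝ, IsUnitSymm B →
        (∃ ε : ℝ, 0 < ε ∧ ∀ x : Fin d → ZMod M,
          ContDiffOn ℝ ⊤ (fun s : ℝ => 𝒞 (A + s • B) k x) (Set.Ioo (-ε) ε)) ∧
        ∀ α : Fin d → ℕ, ∑ i, α i ≤ n → ∀ ℓ : ℕ, ∀ x : Fin d → ZMod M,
          abs (iteratedDeriv ℓ (fun s : ℝ => iterDiff α (𝒞 (A + s • B) k) x) 0)
            ≤ Cα α ℓ / (L : ℝ) ^ ((k - 1) * (d - 2 + ∑ i, α i)))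
    (hd : 2 ≤ d) (hn : 2 ≤ n) (hL : 1 ≤ L)
    {B : Matrix (Fin d) (Fin d) ℝ} (hBu : IsUnitSymm B) {T : ℝ} (hT0 : 0 ≤ T) (hT : T ≤ 1 / 2)
    {k : ℕ} (hk1 : 1 ≤ k) (hkN : k ≤ N + 1) (p : quadIndex d) :
    (L : ℝ) ^ ((k - 1) * d) *
        |gradCov (𝒞 ((1 : Matrix (Fin d) (Fin d) ℝ) + T • B) k) p - gradCov (𝒞 1 k) p| ≤
      secondDiffConst (fun α => Cα α 1) * T := by
  have hL0 : (0 : ℝ) < L := by exact_mod_cast (show 0 < L by omega)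
  have hLpow : 0 < (L : ℝ) ^ ((k - 1) * d) := pow_pos hL0 _
  have hell : ∀ t ∈ Icc 0 T, IsElliptic (1 / 2 : ℝ) 2 ((1 : Matrix (Fin d) (Fin d) ℝ) + t • B) :=
    fun t ht => isElliptic_one_add_smul hBu ht.1 (ht.2.trans hT)
  -- the two second differences defining `γ_p`
  set θ : Fin d → ℕ := Pi.single p.1.2 1 + Pi.single p.1.1 1 with hθ
  set x₀ : Fin d → ZMod M := -(Pi.single p.1.2 1 : Fin d → ZMod M) with hx₀
  have hθ2 : ∑ i, θ i = 2 := by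
    rw [hθ]; simp [Finset.sum_add_distrib, Pi.single_apply]
  have hgrad : ∀ 𝒦 : (Fin d → ZMod M) → ℝ, gradCov 𝒦 p = -iterDiff θ 𝒦 x₀ :=
    fun 𝒦 => gradCov_eq_neg_iterDiff 𝒦 p
  -- differentiability and the derivative bound along the segment
  have hdiff : ∀ t ∈ Icc 0 T, ∀ y, DifferentiableAt ℝ
      (fun s : ℝ => (fun A => 𝒞 A k) ((1 : Matrix (Fin d) (Fin d) ℝ) + t • B + s • B) y) 0 := by
    intro t ht y
    obtain ⟨ε, hε, hcd⟩ := (hiv _ (hell t ht) k hk1 hkN B hBu).1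
    have hmem : Set.Ioo (-ε) ε ∈ nhds (0 : ℝ) := Ioo_mem_nhds (by linarith) hε
    exact ((hcd y).differentiableOn (by simp)).differentiableAt hmem
  have hexp : (k - 1) * (d - 2 + ∑ i, θ i) = (k - 1) * d := by rw [hθ2, Nat.sub_add_cancel hd]
  have hbound : ∀ t ∈ Icc 0 T,
      |iteratedDeriv 1 (fun s : ℝ => iterDiff θ ((fun A => 𝒞 A k)
        ((1 : Matrix (Fin d) (Fin d) ℝ) + t • B + s • B)) x₀) 0| ≤ Cα θ 1 / (L : ℝ) ^ ((k - 1) * d) := by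
    intro t ht
    have h := (hiv _ (hell t ht) k hk1 hkN B hBu).2 θ (by omega) 1 x₀
    rw [hexp] at h
    exact h
  have hmv := abs_iterDiff_segment_sub_le (𝒦 := fun A => 𝒞 A k) (A₀ := 1) hT0 θ x₀ hdiff hbound
  -- translate to `γ_p` and multiply by `L^{(k-1)d}`
  have hC : Cα θ 1 ≤ secondDiffConst fun α => Cα α 1 := le_secondDiffConst (fun α => Cα α 1) hθ2
  rw [hgrad, hgrad, show -iterDiff θ (𝒞 ((1 : Matrix (Fin d) (Fin d) ℝ) + T • B) k) x₀ -
      -iterDiff θ (𝒞 1 k) x₀ = -(iterDiff θ (𝒞 ((1 : Matrix (Fin d) (Fin d) ℝ) + T • B) k) x₀ -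
        iterDiff θ (𝒞 1 k) x₀) by ring, abs_neg]
  calc (L : ℝ) ^ ((k - 1) * d) *
        |iterDiff θ (𝒞 ((1 : Matrix (Fin d) (Fin d) ℝ) + T • B) k) x₀ - iterDiff θ (𝒞 1 k) x₀|
      ≤ (L : ℝ) ^ ((k - 1) * d) * (Cα θ 1 / (L : ℝ) ^ ((k - 1) * d) * T) :=
        mul_le_mul_of_nonneg_left hmv hLpow.le
    _ = Cα θ 1 * T := by field_simp
    _ ≤ secondDiffConst (fun α => Cα α 1) * T := mul_le_mul_of_nonneg_right hC hT0

end Literature.MathematicalPhysics.StatisticalMechanics.GradientRG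

end
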